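import Summits.Parity.GeneralizedHardyLittlewood.Theorems.LeeYangFibresAbsoluteUpgradeQuantClip
import Summits.Parity.GeneralizedHardyLittlewood.Theorems.LeeYangFibresAbsoluteUpgradePencilDisc
import Summits.Parity.GeneralizedHardyLittlewood.Theorems.LeeYangFibresAbsoluteUpgradePencilChainZero
import Summits.Parity.GeneralizedHardyLittlewood.Theorems.LeeYangFibresAbsoluteUpgradeModGammaAssembly
import Summits.Parity.GeneralizedHardyLittlewood.Theorems.LeeYangFibresAbsoluteUpgradeModGammaEin
import Summits.Parity.GeneralizedHardyLittlewood.Theorems.LeeYangFibresAbsoluteUpgradeModGammaAsymp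
import Summits.Parity.GeneralizedHardyLittlewood.Theorems.LeeYangFibresAbsoluteUpgradeModGammaInvariant
import Summits.Parity.GeneralizedHardyLittlewood.Theorems.LeeYangFibresAbsoluteUpgradeModGammaAdjointEq
import Summits.Parity.GeneralizedHardyLittlewood.Theorems.LeeYangFibresAbsoluteUpgradeModGammaInvariantValue
import Summits.Parity.GeneralizedHardyLittlewood.Theorems.LeeYangFibresAbsoluteUpgradeCellsToDimOne
import Summits.Parity.GeneralizedHardyLittlewood.Theorems.LeeYangFibresAbsoluteUpgradeAnatomyAlong
import HarnessLib

/-!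
# Route `LeeYangFibres`, crux `AbsoluteUpgrade` (stmt-Parity-14116) — line `dip-margin-rate-exchange`: the reduction theorem

Everything provable in the line is now kernel-checked; this file composes it (lead seat c1, cycle 1).

* `modGammaDisc : ModGammaDisc` — UNCONDITIONAL: the mod-Gamma disc asymptotic of the Buchstab–Dickman row,
  `Σ_{j<u} I_{j+1}(u) z^j = e^{−γz}(u−1)^z/Γ(1+z) · (1 + O_K(1/u))` uniformly on `|z| ≤ K+1`, by the ADJOINT METHOD
  (`modGammaDisc_of_adjoint` fed with `mg_ein`, `mg_adjointEq`, `mg_adjointAsymp`, `mg_invariantValue`, `mg_invariantConst`).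
* `marginPoly : MarginPoly` — UNCONDITIONAL, the line's one new parity-free theorem: the real-rootedness threshold of the
  Buchstab–Dickman pencil `F_u(z) + θF_u(−z)` decays faster than every power of `u`, robustly (pencil zero + Rouché:
  `stub_pencilDiscOfChain pencil_chainZero modGammaDisc`).
* `dimOne_of_dipInputs : CellParityLawSaving → FibreHyperbolicityAlong → DimOne` — the line's REDUCTION: Hardy–Littlewood-type
  ABSOLUTE asymptotics for every non-degenerate `d = 1` system (`DimOne`) follow from the two `u`-uniform / rate-bearing clauses of
  the route's cruxes 3 and 2 along the schedule `u = U(N) = max 4 ⌊√(log log N)/2⌋` (the cell-parity law with a `(log N)^{−δ}`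
  saving; the Lee–Yang property of the joint rough-cell fibres). `RelativeDimOne` is not used: the guarded crux
  `AbsoluteUpgrade := RelativeDimOne → DimOne` follows a fortiori (`absoluteUpgrade_of_dipInputs`).
-/

namespace Summit.Parity.GeneralizedHardyLittlewood.Cruxes.AbsoluteUpgrade.DipMarginRateExchange

open Summit.Parity.GeneralizedHardyLittlewood.Theses.LeeYangFibres

/-- **The mod-Gamma disc asymptotic of the Buchstab–Dickman row (unconditional).** For every `K` there are `C, u₀` with
`|Σ_{j<u} I_{j+1}(u) z^j − e^{−γz}(u−1)^z/Γ(1+z)| ≤ (C/u)|(u−1)^z|` for all `u ≥ u₀`, `|z| ≤ K+1` — the registered stub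
`stub_modGammaDisc` of the line, discharged by the adjoint method of the sieve literature (Greaves 2001 §4.2):
regularised `Γ`-normalised adjoint `adjTilde`, its adjoint equation with analytic continuation in `z`, Watson asymptotics,
the invariant pairing with the row and its value `1/Γ(1+z)`, continuous induction and division. [cite: Greaves2001, §4.2] -/
theorem modGammaDisc : ModGammaDisc :=
  modGammaDisc_of_adjoint (mg_adjointAsymp mg_ein) (mg_invariantValue mg_ein (mg_adjointEq mg_ein))
    (mg_invariantConst (mg_adjointEq mg_ein))

/-- **MARGIN-POLY (unconditional; the line's new parity-free theorem).** For every `m` and all large `u`, every non-negative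
row `b` within relative `u^{−m−4}` plus absolute `u^{−u}` of the tilted Buchstab–Dickman row `(1 + θ(−1)^j) I_{j+1}(u)`,
`u^{−m} ≤ |θ| ≤ 2`, has a NON-REAL zero: the registered stub `stub_marginPoly`, as `stub_pencilDiscOfChain pencil_chainZero
modGammaDisc` (an explicit zero of the model pencil `e^{2Λζ}Γ(1−ζ) = −θΓ(1+ζ)` at height `Im ζ ≈ 1` with a clearance circle,
transferred to the row polynomial by the maximum-modulus Rouché lemma through the disc asymptotic). -/
theorem marginPoly : MarginPoly := stub_pencilDiscOfChain pencil_chainZero modGammaDisc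

/-- **The reduction theorem of line `dip-margin-rate-exchange`.** The cell-parity law along the schedule with a log-power
saving (`CellParityLawSaving`) and fibre hyperbolicity along the schedule (`FibreHyperbolicityAlong`) imply `DimOne`:
`stub_cellsToDimOne ∘ stub_quantClip` with the unconditional `marginPoly` and `stub_anatomyAlong` — every factor kernel-checked;
the two hypotheses are exactly the registered conjectural stubs of the skeleton with their `RelativeDimOne` guard removed. -/
theorem dimOne_of_dipInputs : CellParityLawSaving → FibreHyperbolicityAlong → DimOne := fun hL hF =>
  Summit.Parity.GeneralizedHardyLittlewood.Theorems.AbsoluteUpgrade.stub_cellsToDimOne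
    (stub_quantClip hL hF marginPoly stub_anatomyAlong)

/-- **The crux from the two inputs.** `AbsoluteUpgrade := RelativeDimOne → DimOne` follows from `CellParityLawSaving` and
`FibreHyperbolicityAlong` (the guard `RelativeDimOne` is not used). -/
theorem absoluteUpgrade_of_dipInputs : CellParityLawSaving → FibreHyperbolicityAlong → AbsoluteUpgrade :=
  fun hL hF _ => dimOne_of_dipInputs hL hF

end Summit.Parity.GeneralizedHardyLittlewood.Cruxes.AbsoluteUpgrade.DipMarginRateExchange
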